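import Summits.HubbardSuperconductivity.HubbardSuperconductivity.Theorems.BalabanIRBirEveryGroundStateThermalChordCore
import Summits.HubbardSuperconductivity.HubbardSuperconductivity.Theorems.BalabanIRBirEveryGroundStateSocket
import Summits.HubbardSuperconductivity.HubbardSuperconductivity.Theorems.BalabanIRBirGappedPhaseReductionStructural
import Literature.MathematicalPhysics.QuantumLattice.PairChirality
import Summits.HubbardSuperconductivity.Statement
import HarnessLib

/-!
# Route `BalabanIR`, crux 5 `BirEveryGroundState` (`stmt-HubbardSuperconductivity-2083`):
# EVERY ground state from a THERMAL κ-chord — the engine-facing closer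

The crux "average ⇒ every" is, as typed, engine-free and equivalent
(`Theorems.birEveryGroundState_iff_transfer`) to a Hubbard-specific no-dark-ground-state statement
for which no source exists (`Cruxes/BirEveryGroundState/Disproof.lean`: false in the abstract,
realised-false at the anomalous torus `L = 4`). This module proves the degeneracy-blind,
genericity-free alternative in the currency a functional-integral ENGINE actually delivers —
sector partition functions at finite inverse temperature — so that "every ground state" can be
paid for by the engine (cruxes 2–4) instead of by a genericity conjecture. The finite-dimensional
core (`thermalChord_le_re_rayleigh`: one-vector Peierls–Bogoliubov against the entropy budget
`re tr (P_K e^{-βH}) ≤ dim K · e^{-βe₀}`) is in `BalabanIRBirEveryGroundStateThermalChordCore`.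

* `thermalChord_groundState_bound_hubbardTorus` — on `hubbardTorus 2 L 1 U`, sector
  `S = (2⌊(1-δ)L²/2⌋, S^z = 0)` with projection `P_S`, `Y_L = L⁻⁴ Δ_d† Δ_d`, `κ, β > 0`, every
  normalised sector ground state `ψ` has
  `(log Z_S(β,H) - log Z_S(β,H+κY_L) - L² log 4)/(βκ) ≤ re ⟨ψ, Y_L ψ⟩`, `Z_S(β,X) = re tr (P_S e^{-βX})`
  (budget `log dim S ≤ L² log 4`, `finrank_szSector_fermionTorus_le`).
* `forall_groundState_bound_of_thermalChord`, `hasLRO_of_thermalChord` — THE CLOSER at one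
  coupling: if for some `κ, a > 0`, eventually in even `L`, at SOME `β > 0`,
  `β κ a + L² log 4 ≤ log Z_S(β, H) - log Z_S(β, H + κ Y_L)` (necessarily `β ≳ L²/(κa)`, inside the
  engine's `M ≫ L²` regime), then every normalised sector ground state has
  `a L⁴ ≤ re ⟨ψ, Δ_d† Δ_d ψ⟩`, hence (`forall_hasLRO_iff_groundState_bound`) the summit's
  every-ground-state `d_{x²-y²}` pair-field LRO at `(U, δ)`. No genericity, no `β → ∞`, no gap.
* `birEveryGroundState_structural_of_thermalChord` — the body of `BirEveryGroundState`, verbatim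
  and route-file-free, from "window average ⇒ thermal chord at one coupling of the window"
  (socket `birEveryGroundState_structural_of_transfer`).
* `hubbardSuperconductivity_of_thermalChord` — the RE-CUT this suggests to the planner: a
  thermal κ-chord at ONE `(δ, U)` gives the summit outright (no window, no crux 5).

Relation to the `T = 0` chord of `Theorems.birEveryGroundState_structural_of_kappaChord`
(`κ a ≤ minEnergyOn (H + κ Y_L) S - minEnergyOn H S`): as `β → ∞`,
`(log Z_S(β,H) - log Z_S(β,H+κY_L))/β` tends to that energy difference, so the thermal chord at `L`
is the zero-temperature chord with a strict margin, read at a finite `β ≥ L² log 4 /(margin)`; in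
the engine's path measure it says `⟨e^{-κ β Ȳ}⟩_S ≤ e^{-β κ a - L² log 4}` for the imaginary-time
average `Ȳ` of the slice order — histories with small time-averaged `d`-wave order cost free
energy at rate `> κ a`. The pair-phase twist (flux `hc/2e`) states are pair-dark at energy
`E₀ + O(ρ_s)`, so that rate is `O(1)`, never extensive: `κ Y_L` with `Y_L = O(1)` is the right
scaling (a penalty `κ L⁻² Δ_d† Δ_d` with an extensive increment would be false), and a fixed-`β`
version is false by Koma–Tasaki (no superconducting order at `T > 0` in two dimensions) —
consistent, since here `β` grows with `L`.

This module imports NO route file (rev-5 materialisation rule). Sources: B. Simon, *The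
Statistical Mechanics of Lattice Gases* I (1993) §II.13; Bratteli–Robinson II §5.3.1; Tasaki
(2020) App. A; Scalapino, Phys. Rep. 250 (1995) §2; Koma–Tasaki, PRL 68 (1992) 3248. Folklore;
no definition is introduced.
-/

noncomputable section

open scoped Matrix.Norms.L2Operator ComplexOrder MatrixOrder InnerProductSpace

namespace Summit.HubbardSuperconductivity.HubbardSuperconductivity.Theorems

open Matrix Finset Filter Literature.MathematicalPhysics.QuantumLattice
open Literature.Probability.LatticeModels

/-! ### The Hubbard torus -/

section Hubbard

/-- The entropy budget of a sector of the Hubbard torus: `dim szSector N M ≤ 4^{L²}` (a sector is a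
subspace of the `2^{2L²}`-dimensional Fock space of `Orb (FermionTorus 2 L) = Λ_L × Fin 2`).
[folklore] -/
theorem finrank_szSector_fermionTorus_le (L N : ℕ) (M : ℝ) :
    Module.finrank ℂ (szSector (Λ := FermionTorus 2 L) N M) ≤ 4 ^ (L ^ 2) := by
  refine (Submodule.finrank_le _).trans (le_of_eq ?_)
  rw [Module.finrank_fintype_fun_eq_card, Fintype.card_finset]
  have hΛ : Fintype.card (FermionTorus 2 L) = L ^ 2 := by simp
  have hcard : Fintype.card (Orb (FermionTorus 2 L)) = 2 * L ^ 2 := by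
    rw [show Fintype.card (Orb (FermionTorus 2 L)) = Fintype.card (FermionTorus 2 L × Fin 2) from
      Fintype.card_lex _, Fintype.card_prod, Fintype.card_fin, hΛ, mul_comm]
  rw [hcard, pow_mul]
  norm_num

/-- **Every sector ground state from a thermal κ-chord, on the Hubbard torus.** Side `L ≥ 1`,
coupling `U`, `δ ≥ -1`, `κ, β > 0`; `H = hubbardTorus 2 L 1 U`, `S` the
`(2⌊(1-δ)L²/2⌋, S^z = 0)` sector with projection `P_S`, `Y_L = L⁻⁴ Δ_d† Δ_d`. Then every
normalised sector ground state `ψ` obeys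
`(log re tr (P_S e^{-βH}) - log re tr (P_S e^{-β(H + κ Y_L)}) - L² log 4) / (β κ) ≤ re ⟨ψ, Y_L ψ⟩`
(`thermalChord_le_re_rayleigh` with the sector invariant under `H`,
`szSector_invariant_hubbardTorus`, and `log dim S ≤ L² log 4`, `finrank_szSector_fermionTorus_le`).
B. Simon, *Statistical Mechanics of Lattice Gases* I §II.13; Tasaki (2020) App. A. [folklore] -/
theorem thermalChord_groundState_bound_hubbardTorus (L : ℕ) [NeZero L] (U δ : ℝ)
    {κ β : ℝ} (hκ : 0 < κ) (hβ : 0 < β) {ψ : Fock (Orb (FermionTorus 2 L))}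
    (hgs : IsGroundStateInSector (hubbardTorus 2 L 1 U) (2 * ⌊(1 - δ) * (L : ℝ) ^ 2 / 2⌋₊) 0 ψ)
    (hψ : star ψ ⬝ᵥ ψ = 1) :
    let N : ℕ := 2 * ⌊(1 - δ) * (L : ℝ) ^ 2 / 2⌋₊
    let H := hubbardTorus 2 L 1 U
    let S := szSector (Λ := FermionTorus 2 L) N 0
    let PS := projMatrix (S.map (Fock.toEuclidean (ι := Orb (FermionTorus 2 L)) :
      Fock (Orb (FermionTorus 2 L)) →ₗ[ℂ] EuclideanSpace ℂ (Finset (Orb (FermionTorus 2 L)))))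
    let Yd : Matrix (Finset (Orb (FermionTorus 2 L))) (Finset (Orb (FermionTorus 2 L))) ℂ :=
      ((1 : ℂ) / (L : ℂ) ^ 4) • ((pairField dWaveFormFactor L)ᴴ * pairField dWaveFormFactor L)
    (Real.log (PS * gibbsWeight β H).trace.re -
        Real.log (PS * gibbsWeight β (H + (κ : ℂ) • Yd)).trace.re -
        (L : ℝ) ^ 2 * Real.log 4) / (β * κ) ≤ (star ψ ⬝ᵥ Yd *ᵥ ψ).re := by
  intro N H S PS Yd
  have hH : H.IsHermitian := LiebThm1.hamiltonian_isHermitian (fermionTorusGraph 2 L) 1 U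
  have hinv : ∀ v ∈ S, H *ᵥ v ∈ S := fun v hv => szSector_invariant_hubbardTorus 2 L 1 U _ hv
  have hA : ((pairField dWaveFormFactor L)ᴴ * pairField dWaveFormFactor L).IsHermitian :=
    isHermitian_conjTranspose_mul_self _
  have hYd : Yd.IsHermitian := by
    refine hA.smul ?_
    rw [isSelfAdjoint_iff, Complex.star_def, map_div₀, map_one, map_pow, Complex.conj_natCast]
  have h : (Real.log (PS * gibbsWeight β H).trace.re -
      Real.log (PS * gibbsWeight β (H + (κ : ℂ) • Yd)).trace.re -
      Real.log (Module.finrank ℂ S)) / (β * κ) ≤ (star ψ ⬝ᵥ Yd *ᵥ ψ).re :=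
    thermalChord_le_re_rayleigh hH hYd S hinv hgs.1 hψ hgs.2.2 hκ hβ
  -- replace `log dim S` by the budget `L² log 4`
  have hd1 : (1 : ℝ) ≤ Module.finrank ℂ S := by
    have hψ0 : ψ ≠ 0 := hgs.2.1
    have : 0 < Module.finrank ℂ S := Module.finrank_pos_iff_exists_ne_zero.mpr
      ⟨⟨ψ, hgs.1⟩, fun h => hψ0 (by simpa using congrArg Subtype.val h)⟩
    exact_mod_cast this
  have hbudget : Real.log (Module.finrank ℂ S) ≤ (L : ℝ) ^ 2 * Real.log 4 := by
    have h4 : (Module.finrank ℂ S : ℝ) ≤ (4 : ℝ) ^ (L ^ 2) := by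
      exact_mod_cast finrank_szSector_fermionTorus_le L N 0
    calc Real.log (Module.finrank ℂ S) ≤ Real.log ((4 : ℝ) ^ (L ^ 2)) :=
          Real.log_le_log (by linarith) h4
      _ = (L : ℝ) ^ 2 * Real.log 4 := by rw [Real.log_pow]; push_cast; ring
  refine le_trans ?_ h
  exact div_le_div_of_nonneg_right (by linarith) (by positivity)

/-- **THE CLOSER AT ONE COUPLING: thermal κ-chord ⇒ every-ground-state bound.** Fix `U`, `δ`,
`κ > 0`, `a` and `L₀`. Suppose that at every even side `L ≥ L₀` there is SOME `β > 0` with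
`β κ a + L² log 4 ≤ log re tr (P_S e^{-βH}) - log re tr (P_S e^{-β(H + κ Y_L)})`
(`H = hubbardTorus 2 L 1 U`, `S` the `(2⌊(1-δ)L²/2⌋, S^z = 0)` sector, `Y_L = L⁻⁴ Δ_d† Δ_d`:
the pair penalty `κ Y_L` raises the sector free energy by at least `κ a + L² log 4 / β`). Then
every normalised sector ground state at every even `L ≥ L₀` has `a L⁴ ≤ re ⟨ψ, Δ_d† Δ_d ψ⟩`
(`thermalChord_groundState_bound_hubbardTorus`). Degeneracy-blind; no genericity, no `β → ∞`.
B. Simon, *Statistical Mechanics of Lattice Gases* I §II.13; Scalapino (1995) §2. [folklore] -/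
theorem forall_groundState_bound_of_thermalChord (U δ : ℝ) {κ : ℝ} (hκ : 0 < κ) (a : ℝ)
    (L₀ : ℕ)
    (h : ∀ (L : ℕ) [NeZero L], L₀ ≤ L → Even L → ∃ β : ℝ, 0 < β ∧
      let N : ℕ := 2 * ⌊(1 - δ) * (L : ℝ) ^ 2 / 2⌋₊
      let H := hubbardTorus 2 L 1 U
      let S := szSector (Λ := FermionTorus 2 L) N 0
      let PS := projMatrix (S.map (Fock.toEuclidean (ι := Orb (FermionTorus 2 L)) :
        Fock (Orb (FermionTorus 2 L)) →ₗ[ℂ] EuclideanSpace ℂ (Finset (Orb (FermionTorus 2 L)))))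
      let Yd : Matrix (Finset (Orb (FermionTorus 2 L))) (Finset (Orb (FermionTorus 2 L))) ℂ :=
        ((1 : ℂ) / (L : ℂ) ^ 4) • ((pairField dWaveFormFactor L)ᴴ * pairField dWaveFormFactor L)
      β * κ * a + (L : ℝ) ^ 2 * Real.log 4 ≤
        Real.log (PS * gibbsWeight β H).trace.re -
          Real.log (PS * gibbsWeight β (H + (κ : ℂ) • Yd)).trace.re) :
    ∀ (L : ℕ) [NeZero L], L₀ ≤ L → Even L → ∀ ψ : Fock (Orb (FermionTorus 2 L)),
      IsGroundStateInSector (hubbardTorus 2 L 1 U) (2 * ⌊(1 - δ) * (L : ℝ) ^ 2 / 2⌋₊) 0 ψ →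
      star ψ ⬝ᵥ ψ = 1 →
      a * (L : ℝ) ^ 4 ≤
        (star ψ ⬝ᵥ ((pairField dWaveFormFactor L)ᴴ * pairField dWaveFormFactor L) *ᵥ ψ).re := by
  intro L _ hL hLe ψ hgs hψ
  obtain ⟨β, hβ, hch⟩ := h L hL hLe
  simp only at hch
  have hb := thermalChord_groundState_bound_hubbardTorus L U δ hκ hβ hgs hψ
  simp only at hb
  set A : Matrix (Finset (Orb (FermionTorus 2 L))) (Finset (Orb (FermionTorus 2 L))) ℂ :=
    (pairField dWaveFormFactor L)ᴴ * pairField dWaveFormFactor L with hA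
  have hL4 : (0 : ℝ) < (L : ℝ) ^ 4 := by
    have : (0 : ℝ) < (L : ℝ) := Nat.cast_pos.mpr (Nat.pos_of_ne_zero (NeZero.ne L))
    positivity
  have hexp : (star ψ ⬝ᵥ (((1 : ℂ) / (L : ℂ) ^ 4) • A) *ᵥ ψ).re =
      (star ψ ⬝ᵥ A *ᵥ ψ).re / (L : ℝ) ^ 4 := by
    have hcast : ((1 : ℂ) / (L : ℂ) ^ 4) = (((1 : ℝ) / (L : ℝ) ^ 4 : ℝ) : ℂ) := by push_cast; ring
    rw [smul_mulVec, dotProduct_smul, smul_eq_mul, hcast, Complex.re_ofReal_mul]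
    ring
  rw [div_le_iff₀ (by positivity)] at hb
  have h3 : β * κ * a ≤ β * κ * (star ψ ⬝ᵥ (((1 : ℂ) / (L : ℂ) ^ 4) • A) *ᵥ ψ).re := by
    linarith
  have key : a ≤ (star ψ ⬝ᵥ A *ᵥ ψ).re / (L : ℝ) ^ 4 := by
    rw [← hexp]
    exact le_of_mul_le_mul_left h3 (by positivity)
  rwa [le_div_iff₀ hL4] at key


/-! ### The converse at zero temperature: a strict `T = 0` chord gives the thermal chord -/

/-- `Δ_d† Δ_d` conserves `(N↑, N↓)` (`Δ_d` lowers both by one), hence leaves every sector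
`szSector 2m 0` invariant. [folklore] -/
theorem pairIntensity_mulVec_mem_szSector (L : ℕ) [NeZero L] (m : ℕ)
    {v : Fock (Orb (FermionTorus 2 L))} (hv : v ∈ szSector (Λ := FermionTorus 2 L) (2 * m) 0) :
    ((pairField dWaveFormFactor L)ᴴ * pairField dWaveFormFactor L) *ᵥ v ∈
      szSector (Λ := FermionTorus 2 L) (2 * m) 0 := by
  have hs : PairChirality.Shifts (-1) (-1) (pairField dWaveFormFactor L) :=
    PairChirality.Shifts.sum fun x _ => PairChirality.shifts_localPair L dWaveFormFactor x
  have h := hs.conjTranspose.mul hs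
  simp only [Int.reduceNeg, neg_neg, add_neg_cancel] at h
  rw [mem_szSector_two_mul_zero_iff] at hv ⊢
  exact h.preservesSectors.isInSector_mulVec hv

/-- **A strict zero-temperature κ-chord gives the thermal κ-chord.** On the Hubbard torus (side
`L ≥ 1`, `δ ≥ -1`, any real `κ`, `a`): if `κ a < minEnergyOn (H + κ Y_L) S - minEnergyOn H S` (the
hypothesis of `Theorems.birEveryGroundState_structural_of_kappaChord`, with a strict margin), then
some `β > 0` has `β κ a + L² log 4 ≤ log re tr (P_S e^{-βH}) - log re tr (P_S e^{-β(H + κ Y_L)})`.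
(`log re tr (P_S e^{-βH}) ≥ -β e₀(H)` by one ground state; `log re tr (P_S e^{-β(H+κY_L)}) ≤
L² log 4 - β e₀(H + κY_L)` by the entropy budget, `Y_L` preserving the sector; take
`β = (2 L² log 4 + 1)/margin`.) So at `T = 0` the thermal re-cut asks no more than the energy chord.
B. Simon (1993) §II.13; Tasaki (2020) App. A. [folklore] -/
theorem thermalChord_of_strict_kappaChord (L : ℕ) [NeZero L] (U δ : ℝ) (hδ : -1 ≤ δ) (κ a : ℝ) :
    let N : ℕ := 2 * ⌊(1 - δ) * (L : ℝ) ^ 2 / 2⌋₊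
    let H := hubbardTorus 2 L 1 U
    let S := szSector (Λ := FermionTorus 2 L) N 0
    let PS := projMatrix (S.map (Fock.toEuclidean (ι := Orb (FermionTorus 2 L)) :
      Fock (Orb (FermionTorus 2 L)) →ₗ[ℂ] EuclideanSpace ℂ (Finset (Orb (FermionTorus 2 L)))))
    let Yd : Matrix (Finset (Orb (FermionTorus 2 L))) (Finset (Orb (FermionTorus 2 L))) ℂ :=
      ((1 : ℂ) / (L : ℂ) ^ 4) • ((pairField dWaveFormFactor L)ᴴ * pairField dWaveFormFactor L)
    κ * a < (H + (κ : ℂ) • Yd).minEnergyOn S - H.minEnergyOn S →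
      ∃ β : ℝ, 0 < β ∧ β * κ * a + (L : ℝ) ^ 2 * Real.log 4 ≤
        Real.log (PS * gibbsWeight β H).trace.re -
          Real.log (PS * gibbsWeight β (H + (κ : ℂ) • Yd)).trace.re := by
  intro N H S PS Yd hgap
  set e₀ : ℝ := H.minEnergyOn S with he₀
  set e₁ : ℝ := (H + (κ : ℂ) • Yd).minEnergyOn S with he₁
  set B : ℝ := (L : ℝ) ^ 2 * Real.log 4 with hB
  have hB0 : 0 ≤ B := by positivity
  set m : ℝ := e₁ - e₀ - κ * a with hm
  have hm0 : 0 < m := by rw [hm]; linarith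
  -- the objects
  have hH : H.IsHermitian := LiebThm1.hamiltonian_isHermitian (fermionTorusGraph 2 L) 1 U
  have hA : ((pairField dWaveFormFactor L)ᴴ * pairField dWaveFormFactor L).IsHermitian :=
    isHermitian_conjTranspose_mul_self _
  have hYd : Yd.IsHermitian := by
    refine hA.smul ?_
    rw [isSelfAdjoint_iff, Complex.star_def, map_div₀, map_one, map_pow, Complex.conj_natCast]
  have hX : (H + (κ : ℂ) • Yd).IsHermitian :=
    hH.add (hYd.smul (by rw [isSelfAdjoint_iff, Complex.star_def, Complex.conj_ofReal]))
  have hinvH : ∀ v ∈ S, H *ᵥ v ∈ S := fun v hv => szSector_invariant_hubbardTorus 2 L 1 U _ hv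
  have hinvX : ∀ v ∈ S, (H + (κ : ℂ) • Yd) *ᵥ v ∈ S := by
    intro v hv
    rw [add_mulVec, smul_mulVec, smul_mulVec]
    exact S.add_mem (hinvH v hv)
      (S.smul_mem _ (S.smul_mem _ (pairIntensity_mulVec_mem_szSector L _ hv)))
  -- a normalised sector ground state of `H`
  obtain ⟨ψ, hψ, hgs⟩ :=
    Literature.Barriers.HubbardSuperconductivity.exists_unit_isGroundStateInSector_hubbardTorus U L
    (⌊(1 - δ) * (L : ℝ) ^ 2 / 2⌋₊) (by
      have hcard := natFloor_density_le_card L δ hδ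
      simpa using hcard)
  have hRH : (star ψ ⬝ᵥ H *ᵥ ψ).re = e₀ := by
    rw [hgs.2.2, dotProduct_smul, hψ, smul_eq_mul, mul_one, Complex.ofReal_re]
  -- choose `β`
  refine ⟨(2 * B + 1) / m, by positivity, ?_⟩
  set β : ℝ := (2 * B + 1) / m with hβdef
  have hβ : 0 < β := by positivity
  have hβm : β * m = 2 * B + 1 := by rw [hβdef, div_mul_cancel₀ _ hm0.ne']
  -- lower bound on `Z_S(β, H)`
  have hZ0 : Real.exp (-(β * e₀)) ≤ (PS * gibbsWeight β H).trace.re := by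
    rw [← hRH]
    exact (exp_neg_mul_rayleigh_le_re_gibbsWeight hH β hψ).trans
      (re_rayleigh_le_re_trace_projMatrix_mul (posDef_gibbsWeight β hH).posSemidef S hgs.1 hψ)
  -- upper bound on `Z_S(β, H + κY)` by the entropy budget, and positivity
  have hZ1 : (PS * gibbsWeight β (H + (κ : ℂ) • Yd)).trace.re ≤
      (Module.finrank ℂ S : ℝ) * Real.exp (-(β * e₁)) :=
    re_trace_sectorProj_mul_gibbsWeight_le hX S hinvX hβ.le
  have hZ1pos : 0 < (PS * gibbsWeight β (H + (κ : ℂ) • Yd)).trace.re :=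
    (Real.exp_pos _).trans_le ((exp_neg_mul_rayleigh_le_re_gibbsWeight hX β hψ).trans
      (re_rayleigh_le_re_trace_projMatrix_mul (posDef_gibbsWeight β hX).posSemidef S hgs.1 hψ))
  have hd1 : (1 : ℝ) ≤ Module.finrank ℂ S := by
    have : 0 < Module.finrank ℂ S := Module.finrank_pos_iff_exists_ne_zero.mpr
      ⟨⟨ψ, hgs.1⟩, fun h => hgs.2.1 (by simpa using congrArg Subtype.val h)⟩
    exact_mod_cast this
  have hbudget : Real.log (Module.finrank ℂ S) ≤ B := by
    have h4 : (Module.finrank ℂ S : ℝ) ≤ (4 : ℝ) ^ (L ^ 2) := by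
      exact_mod_cast finrank_szSector_fermionTorus_le L N 0
    calc Real.log (Module.finrank ℂ S) ≤ Real.log ((4 : ℝ) ^ (L ^ 2)) :=
          Real.log_le_log (by linarith) h4
      _ = B := by rw [hB, Real.log_pow]; push_cast; ring
  -- logarithms
  have hl0 : -(β * e₀) ≤ Real.log (PS * gibbsWeight β H).trace.re := by
    rw [← Real.log_exp (-(β * e₀))]
    exact Real.log_le_log (Real.exp_pos _) hZ0
  have hl1 : Real.log (PS * gibbsWeight β (H + (κ : ℂ) • Yd)).trace.re ≤
      Real.log (Module.finrank ℂ S) + -(β * e₁) := by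
    rw [← Real.log_exp (-(β * e₁)), ← Real.log_mul (by positivity) (Real.exp_pos _).ne']
    exact Real.log_le_log hZ1pos hZ1
  have hme : β * e₁ - β * e₀ = β * m + β * (κ * a) := by rw [hm]; ring
  nlinarith [hl0, hl1, hbudget, hβm, hme, hB0]

/-- **Thermal κ-chord ⇒ the summit's every-ground-state LRO at `(U, δ)`.** For `δ ≥ -1`: if at
coupling `U` there are `κ, a > 0` and `L₀` such that at every even side `L ≥ L₀` some `β > 0`
has `β κ a + L² log 4 ≤ log re tr (P_S e^{-βH}) - log re tr (P_S e^{-β(H + κ Y_L)})`, then EVERY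
admissible sequence of normalised `(2⌊(1-δ)L²/2⌋, S^z = 0)`-sector ground states of
`hubbardTorus 2 L 1 U` has `d_{x²-y²}` pair-field long-range order along the even sides
(`forall_groundState_bound_of_thermalChord` + `forall_hasLRO_iff_groundState_bound`).
Scalapino, Phys. Rep. 250 (1995) §2; B. Simon, *Statistical Mechanics of Lattice Gases* I §II.13.
[folklore] -/
theorem hasLRO_of_thermalChord (U δ : ℝ) (hδ : -1 ≤ δ)
    (h : ∃ κ a : ℝ, 0 < κ ∧ 0 < a ∧ ∃ L₀ : ℕ, ∀ (L : ℕ) [NeZero L], L₀ ≤ L → Even L →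
      ∃ β : ℝ, 0 < β ∧
      let N : ℕ := 2 * ⌊(1 - δ) * (L : ℝ) ^ 2 / 2⌋₊
      let H := hubbardTorus 2 L 1 U
      let S := szSector (Λ := FermionTorus 2 L) N 0
      let PS := projMatrix (S.map (Fock.toEuclidean (ι := Orb (FermionTorus 2 L)) :
        Fock (Orb (FermionTorus 2 L)) →ₗ[ℂ] EuclideanSpace ℂ (Finset (Orb (FermionTorus 2 L)))))
      let Yd : Matrix (Finset (Orb (FermionTorus 2 L))) (Finset (Orb (FermionTorus 2 L))) ℂ :=
        ((1 : ℂ) / (L : ℂ) ^ 4) • ((pairField dWaveFormFactor L)ᴴ * pairField dWaveFormFactor L)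
      β * κ * a + (L : ℝ) ^ 2 * Real.log 4 ≤
        Real.log (PS * gibbsWeight β H).trace.re -
          Real.log (PS * gibbsWeight β (H + (κ : ℂ) • Yd)).trace.re) :
    ∀ (N : ℕ → ℕ) (ψ : ∀ L, Fock (Orb (FermionTorus 2 L))),
      (∀ L, Even L → N L = 2 * ⌊(1 - δ) * (L : ℝ) ^ 2 / 2⌋₊ ∧ star (ψ L) ⬝ᵥ ψ L = 1 ∧
        IsGroundStateInSector (hubbardTorus 2 L 1 U) (N L) 0 (ψ L)) →
      HasLongRangeOrder (fun k => halfOpenBox 2 (2 * k))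
        (fun k => torusPullback (pairFieldCorr dWaveFormFactor ψ) (2 * k)) := by
  obtain ⟨κ, a, hκ, ha, L₀, hL₀⟩ := h
  exact (forall_hasLRO_iff_groundState_bound U δ hδ).2
    ⟨a, ha, L₀, forall_groundState_bound_of_thermalChord U δ hκ a L₀ hL₀⟩

/-- **The body of `Theses.BalabanIR.BirEveryGroundState` (item `stmt-HubbardSuperconductivity-2083`),
verbatim and route-file-free, from "window average ⇒ thermal κ-chord at ONE coupling of the
window".** If for all data `(δ, U₁, U₂, c)` the ground-state-AVERAGE hypothesis on the window
yields a coupling `U ∈ (U₁, U₂)`, constants `κ, a > 0` and a threshold beyond which, at every even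
side, some `β > 0` carries the sector free-energy increment
`β κ a + L² log 4 ≤ log re tr (P_S e^{-βH}) - log re tr (P_S e^{-β(H + κ Y_L)})`, then the item
holds (`hasLRO_of_thermalChord` fed into the socket `birEveryGroundState_structural_of_transfer`
through `forall_groundState_bound_of_thermalChord`). This is the ENGINE-FACING form of the
transfer: the hypothesis is a statement about sector partition functions at finite `β`, which a
functional-integral representation can deliver, and no genericity / irreducibility of ground
multiplets is involved. Scalapino (1995) §2; B. Simon (1993) §II.13. [folklore] -/
theorem birEveryGroundState_structural_of_thermalChord
    (h : ∀ (δ U₁ U₂ c : ℝ), δ ∈ Set.Ioo (0:ℝ) (1/2) → 0 < U₁ → U₁ < U₂ → 0 < c →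
      (∀ U ∈ Set.Ioo U₁ U₂, ∃ L₀ : ℕ, ∀ (L : ℕ) [NeZero L], L₀ ≤ L → Even L →
        let N : ℕ := 2 * ⌊(1 - δ) * (L : ℝ) ^ 2 / 2⌋₊
        let H := hubbardTorus 2 L 1 U
        let S := szSector (Λ := FermionTorus 2 L) N 0
        let E₀ := S ⊓ Module.End.eigenspace (Matrix.toLin' H) ((H.minEnergyOn S : ℝ) : ℂ)
        let P := projMatrix (E₀.map (Fock.toEuclidean (ι := Orb (FermionTorus 2 L)) :
          Fock (Orb (FermionTorus 2 L)) →ₗ[ℂ] EuclideanSpace ℂ (Finset (Orb (FermionTorus 2 L)))))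
        c * (L : ℝ) ^ 4 * P.trace.re ≤
          (P * ((pairField dWaveFormFactor L)ᴴ * pairField dWaveFormFactor L)).trace.re) →
      ∃ U ∈ Set.Ioo U₁ U₂, ∃ κ a : ℝ, 0 < κ ∧ 0 < a ∧ ∃ L₀ : ℕ, ∀ (L : ℕ) [NeZero L],
        L₀ ≤ L → Even L → ∃ β : ℝ, 0 < β ∧
        let N : ℕ := 2 * ⌊(1 - δ) * (L : ℝ) ^ 2 / 2⌋₊
        let H := hubbardTorus 2 L 1 U
        let S := szSector (Λ := FermionTorus 2 L) N 0
        let PS := projMatrix (S.map (Fock.toEuclidean (ι := Orb (FermionTorus 2 L)) :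
          Fock (Orb (FermionTorus 2 L)) →ₗ[ℂ] EuclideanSpace ℂ (Finset (Orb (FermionTorus 2 L)))))
        let Yd : Matrix (Finset (Orb (FermionTorus 2 L))) (Finset (Orb (FermionTorus 2 L))) ℂ :=
          ((1 : ℂ) / (L : ℂ) ^ 4) • ((pairField dWaveFormFactor L)ᴴ * pairField dWaveFormFactor L)
        β * κ * a + (L : ℝ) ^ 2 * Real.log 4 ≤
          Real.log (PS * gibbsWeight β H).trace.re -
            Real.log (PS * gibbsWeight β (H + (κ : ℂ) • Yd)).trace.re) :
    ∀ (δ U₁ U₂ c : ℝ), δ ∈ Set.Ioo (0:ℝ) (1/2) → 0 < U₁ → U₁ < U₂ → 0 < c → (∀ U ∈ Set.Ioo U₁ U₂, ∃ L₀ : ℕ, ∀ (L : ℕ) [NeZero L], L₀ ≤ L → Even L → let N : ℕ := 2 * ⌊(1 - δ) * (L : ℝ) ^ 2 / 2⌋₊; let H := Literature.MathematicalPhysics.QuantumLattice.hubbardTorus 2 L 1 U; let S := Literature.MathematicalPhysics.QuantumLattice.szSector (Λ := Literature.MathematicalPhysics.QuantumLattice.FermionTorus 2 L) N 0; let E₀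 := S ⊓ Module.End.eigenspace (Matrix.toLin' H) ((H.minEnergyOn S : ℝ) : ℂ); let P := Literature.MathematicalPhysics.QuantumLattice.projMatrix (E₀.map (Literature.MathematicalPhysics.QuantumLattice.Fock.toEuclidean (ι := Literature.MathematicalPhysics.QuantumLattice.Orb (Literature.MathematicalPhysics.QuantumLattice.FermionTorus 2 L)) : Literature.MathematicalPhysics.QuantumLattice.Fock (Literature.MathematicalPhysics.QuantumLattice.Orb (Literature.MathematicalPhysics.QuantumLattice.FermionTorus 2 L)) →ₗ[ℂ] EuclideanSpace ℂ (Finset (Literature.MathematicalPhysics.QuantumLattice.Orb (Literature.MathematicalPhysics.QuantumLattice.FermionTorus 2 L))))); c * (L : ℝ) ^ 4 * P.trace.re ≤ (P * (Matrix.conjTranspose (Literature.MathematicalPhysics.QuantumLattice.pairField Literature.MathematicalPhysics.QuantumLattice.dWaveFormFactor L) * Literature.MathematicalPhysics.QuantumLattice.pairField Literature.MathematicalPhysics.QuantumLattice.dWaveFormFactor L)).trace.re) → ∃ U ∈ Set.Ioo U₁ U₂, ∀ (N : ℕ → ℕ) (ψ : ∀ L, Literature.MathematicalPhysics.QuantumLattice.Fock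 (Literature.MathematicalPhysics.QuantumLattice.Orb (Literature.MathematicalPhysics.QuantumLattice.FermionTorus 2 L))), (∀ L, Even L → N L = 2 * ⌊(1 - δ) * (L : ℝ) ^ 2 / 2⌋₊ ∧ star (ψ L) ⬝ᵥ ψ L = 1 ∧ Literature.MathematicalPhysics.QuantumLattice.IsGroundStateInSector (Literature.MathematicalPhysics.QuantumLattice.hubbardTorus 2 L 1 U) (N L) 0 (ψ L)) → Literature.Probability.LatticeModels.HasLongRangeOrder (fun k => Literature.Probability.LatticeModels.halfOpenBox 2 (2 * k)) (fun k => Literature.MathematicalPhysics.QuantumLattice.torusPullback (Literature.MathematicalPhysics.QuantumLattice.pairFieldCorr Literature.MathematicalPhysics.QuantumLattice.dWaveFormFactor ψ) (2 * k)) := by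
  refine birEveryGroundState_structural_of_transfer fun δ U₁ U₂ c hδ hU₁ hU₁₂ hc hyp => ?_
  obtain ⟨U, hU, κ, a, hκ, ha, L₀, hL₀⟩ := h δ U₁ U₂ c hδ hU₁ hU₁₂ hc hyp
  exact ⟨U, hU, a, ha, L₀, forall_groundState_bound_of_thermalChord U δ hκ a L₀ hL₀⟩

/-- **The re-cut this module suggests: a thermal κ-chord at ONE `(δ, U)` gives the summit.**
If for some hole doping `δ ∈ (0, 1/2)` and some repulsion `U > 0` there are `κ, a > 0` and `L₀`
such that at every even side `L ≥ L₀` some `β > 0` has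
`β κ a + L² log 4 ≤ log re tr (P_S e^{-βH}) - log re tr (P_S e^{-β(H + κ Y_L)})`
(`H = hubbardTorus 2 L 1 U`, sector `(2⌊(1-δ)L²/2⌋, S^z = 0)`, `Y_L = L⁻⁴ Δ_d† Δ_d`), then
`HubbardSuperconductivity` holds (`hasLRO_of_thermalChord`). No window of couplings, no
genericity crux: the engine output, strengthened from a ground-state AVERAGE to a sector
free-energy increment under the pair penalty `κ Y_L`, carries "every ground state" by itself.
Conditional on its hypothesis (nothing about the Hubbard model is proved here). Scalapino (1995)
§2; B. Simon (1993) §II.13. [folklore] -/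
theorem hubbardSuperconductivity_of_thermalChord
    (h : ∃ δ ∈ Set.Ioo (0:ℝ) (1/2), ∃ U : ℝ, 0 < U ∧ ∃ κ a : ℝ, 0 < κ ∧ 0 < a ∧ ∃ L₀ : ℕ,
      ∀ (L : ℕ) [NeZero L], L₀ ≤ L → Even L → ∃ β : ℝ, 0 < β ∧
      let N : ℕ := 2 * ⌊(1 - δ) * (L : ℝ) ^ 2 / 2⌋₊
      let H := hubbardTorus 2 L 1 U
      let S := szSector (Λ := FermionTorus 2 L) N 0
      let PS := projMatrix (S.map (Fock.toEuclidean (ι := Orb (FermionTorus 2 L)) :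
        Fock (Orb (FermionTorus 2 L)) →ₗ[ℂ] EuclideanSpace ℂ (Finset (Orb (FermionTorus 2 L)))))
      let Yd : Matrix (Finset (Orb (FermionTorus 2 L))) (Finset (Orb (FermionTorus 2 L))) ℂ :=
        ((1 : ℂ) / (L : ℂ) ^ 4) • ((pairField dWaveFormFactor L)ᴴ * pairField dWaveFormFactor L)
      β * κ * a + (L : ℝ) ^ 2 * Real.log 4 ≤
        Real.log (PS * gibbsWeight β H).trace.re -
          Real.log (PS * gibbsWeight β (H + (κ : ℂ) • Yd)).trace.re) :
    _root_.HubbardSuperconductivity := by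
  obtain ⟨δ, hδ, U, hU, κ, a, hκ, ha, L₀, hL₀⟩ := h
  show Literature.Hubbard.DWaveSuperconductivityHubbard
  exact ⟨U, hU, δ, hδ, hasLRO_of_thermalChord U δ (by linarith [hδ.1]) ⟨κ, a, hκ, ha, L₀, hL₀⟩⟩

/-- **Registered form** (sub-goal `thermalChordSummit` of item `stmt-HubbardSuperconductivity-2083`):
`hubbardSuperconductivity_of_thermalChord` as a closed implication. [folklore] -/
theorem thermalChordSummit : (∃ δ ∈ Set.Ioo (0:ℝ) (1/2), ∃ U : ℝ, 0 < U ∧ ∃ κ a : ℝ, 0 < κ ∧ 0 < a ∧ ∃ L₀ : ℕ, ∀ (L : ℕ) [NeZero L], L₀ ≤ L → Even L → ∃ β : ℝ, 0 < β ∧ let N : ℕ := 2 * ⌊(1 - δ) * (L : ℝ) ^ 2 / 2⌋₊; let H := Literature.MathematicalPhysics.QuantumLattice.hubbardTorus 2 L 1 U; let S := Literature.MathematicalPhysics.QuantumLattice.szSector (Λ := Literature.MathematicalPhysics.QuantumLattice.FermionTorus 2 L) N 0; let PS := Literature.MathematicalPhysics.QuantumLattice.projMatrix (S.map (Literature.MathematicalPhysics.QuantumLattice.Fock.toEuclidean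 (ι := Literature.MathematicalPhysics.QuantumLattice.Orb (Literature.MathematicalPhysics.QuantumLattice.FermionTorus 2 L)) : Literature.MathematicalPhysics.QuantumLattice.Fock (Literature.MathematicalPhysics.QuantumLattice.Orb (Literature.MathematicalPhysics.QuantumLattice.FermionTorus 2 L)) →ₗ[ℂ] EuclideanSpace ℂ (Finset (Literature.MathematicalPhysics.QuantumLattice.Orb (Literature.MathematicalPhysics.QuantumLattice.FermionTorus 2 L))))); let Yd : Matrix (Finset (Literature.MathematicalPhysics.QuantumLattice.Orb (Literature.MathematicalPhysics.QuantumLattice.FermionTorus 2 L))) (Finset (Literature.MathematicalPhysics.QuantumLattice.Orb (Literature.MathematicalPhysics.QuantumLattice.FermionTorus 2 L))) ℂ := ((1 : ℂ) / (L : ℂ) ^ 4) • (Matrix.conjTranspose (Literature.MathematicalPhysics.QuantumLattice.pairField Literature.MathematicalPhysics.QuantumLattice.dWaveFormFactor L) * Literature.MathematicalPhysics.QuantumLattice.pairField Literature.MathematicalPhysics.QuantumLattice.dWaveFormFactor L); β * κ * a + (L : ℝ) ^ 2 * Real.log 4 ≤ Real.log (PS * Matrix.gibbsWeight β H).trace.re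 - Real.log (PS * Matrix.gibbsWeight β (H + (κ : ℂ) • Yd)).trace.re) → HubbardSuperconductivity :=
  fun h => hubbardSuperconductivity_of_thermalChord h

end Hubbard

end Summit.HubbardSuperconductivity.HubbardSuperconductivity.Theorems
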